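import Summits.BirchSwinnertonDyer.Rank1Residual.X12.CubeSumFamilies
import Literature.NumberTheory.EllipticCurves.HeegnerPointsKolyvaginPrimaryLocalTrivialProofs
import Literature.NumberTheory.EllipticCurves.HeegnerPointsKolyvaginPrimaryCebotarevProofs
import Literature.NumberTheory.EllipticCurves.HuShuYin2019.SylvesterPairGoodPlaces
import Literature.NumberTheory.EllipticCurves.JZeroKolyvaginPrimes
import HarnessLib

/-!
# The COUPLED Cassels–Tate telescope, XXIV: the «Kolyvagin primes' level» leaf of RESIDUE c v3 —
# `X_K[2^κ·2^κ] ⊆ X_K(K_λ)` at every Kolyvagin prime of the level, for both curves of the Sylvester pair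

Crux `UpperOffV0HSYPlus` (stmt-BirchSwinnertonDyer-19804), rows' display RESIDUE c v3 (`…TailFourOfResidue` p714972,
l.113–120; twin `…TailSevenOfResidue`): for every `r` with `Kol r`, every place `q ∋ r` of `K`, every
`g ∈ Γ_{K_q}` and every `Q ∈ X_K[2^κ·2^κ]`: `res(g) • Q = Q` (`X ∈ {E_{3p²}, E_p}`).  With the rows' `Kol` of
`…CebotarevKernelPairSylvester` (ℓ prime, `ℓ ∤ N_A`, `ℓ ∤ N_B`, `ℓ ∤ d_K`, `ℓ ≠ 2`, `(ℓ)` prime,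
`Frob ℓ = Frob ∞` on `K(A[2^κ·2^κ])` and on `K(B[2^κ·2^κ])`, `b₀ < ℓ`) and the assembler's `3p ∣ N_A`, this is the
tree's `absGaloisRestrict_smul_geomTorsion_eq_of_kolyvaginPrime` (McCallum 1991 §4: «`λ` splits completely in
`K(E_{p^M})`, hence `E(K_λ)_{p^M} = E_{p^M}`») once per curve: the Kolyvagin-prime package at level `2` comes from
`FrobEqFrobInfty.of_dvd`, good reduction at `λ ∤ 3p` from `hasGoodReductionAt_cubeSumCurve_{prime,three_mul_sq}_baseChange`
(HSY 2019 §1), `λ ∤ 2^κ·2^κ` from `ℓ ≠ 2`, and the place `q ∋ ℓ` IS `λ = (ℓ)` ((ℓ) is maximal).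
* `absGaloisRestrict_smul_geomTorsion_eq_of_frob_of_good` — generic: one curve `X/ℚ`, level `N = 2^M`.
* ★ `kolyvaginLevel_trivial_sylvesterPair` — RESIDUE l.113–120 for the rows' `Kol` (both curves), display order.
Theorem-only (no definition, no named fact); nothing asserted on 19804; no stub closed; X12.CMAtTwo NOT proved;
BSD not claimed for any curve.  Sources: McCallum 1991 §4; Gross 1991 §3 (3.1)–(3.2); Neukirch ANT II (9.6).
-/

-- every Summits module is named `Summit.<Summit>.<Problem>…`: the duplicated component is by design
set_option linter.dupNamespace false
set_option autoImplicit false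

noncomputable section

open scoped Classical
open WeierstrassCurve NumberField IsDedekindDomain Field
open Literature.NumberTheory.EllipticCurves Literature.NumberTheory.GaloisRepresentations
  Literature.NumberTheory.EllipticCurves.HuShuYin2019

namespace Summit.BirchSwinnertonDyer.BirchSwinnertonDyer.Theorems.SylvesterTwoCoupledTelescope

variable {K : Type} [Field K] [NumberField K]

/-- **`Γ_{K_q}` fixes `X_K[N]` at a prime `q ∋ ℓ` when `ℓ` is a Kolyvagin prime of level `N = 2^M` for `X`**
(generic: `K` imaginary quadratic, `ℓ` prime, `ℓ ∤ N₀`, `ℓ ∤ d_K`, `ℓ ≠ 2`, `(ℓ)` prime, `Frob ℓ = Frob ∞` on `K(X[N])`,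
`X_K` of good reduction at `(ℓ)`).  The tree's `absGaloisRestrict_smul_geomTorsion_eq_of_kolyvaginPrime` at the place
`(ℓ)`, which is the only place above `ℓ`. [cite: McCallumLMS1991, §4] [cite: GrossLMS1991, §3 (3.2)] -/
theorem absGaloisRestrict_smul_geomTorsion_eq_of_frob_of_good (X : WeierstrassCurve ℚ) [X.IsElliptic]
    (hK : IsImaginaryQuadratic K) {N₀ ℓ : ℕ} (hℓ : ℓ.Prime) (hℓN₀ : ¬ ℓ ∣ N₀)
    (hℓd : ¬ ((ℓ : ℤ) ∣ NumberField.discr K)) (hℓ2 : ℓ ≠ 2) (hℓP : (Ideal.span {(ℓ : 𝓞 K)}).IsPrime)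
    (N : ℕ) [NeZero N] {M : ℕ} (hN : N = 2 ^ M) (hM : 1 ≤ M) (hfrob : FrobEqFrobInfty X K N ℓ)
    (hgood : ∀ w : HeightOneSpectrum (𝓞 K), (ℓ : 𝓞 K) ∈ w.asIdeal → (X.baseChange K).HasGoodReductionAt w) :
    ∀ q : HeightOneSpectrum (𝓞 K), (ℓ : 𝓞 K) ∈ q.asIdeal →
      ∀ (g : absoluteGaloisGroup (Place.Completion (Sum.inr q : Place K))) (Q : geomTorsion (X.baseChange K) (N : ℤ)),
        absGaloisRestrict K (Place.Completion (Sum.inr q : Place K)) g • Q = Q := by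
  intro q hq g Q
  have h2N : 2 ∣ N := by rw [hN]; exact dvd_pow_self 2 (by omega)
  have hkol : IsKolyvaginPrime N₀ X K 2 ℓ := ⟨hℓ, hℓN₀, hℓd, hℓ2, hℓP, FrobEqFrobInfty.of_dvd h2N hfrob⟩
  -- the place `q ∋ ℓ` is `λ = (ℓ)`
  have hqeq : hkol.place = q := by
    apply HeightOneSpectrum.ext
    exact (hkol.place.isPrime.isMaximal hkol.place.ne_bot).eq_of_le q.isPrime.ne_top
      ((Ideal.span_singleton_le_iff_mem _).mpr hq)
  subst hqeq
  have hbad : hkol.place ∉ (X.baseChange K).badPlaces (𝓞 K) := by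
    rw [WeierstrassCurve.mem_badPlaces_iff, not_not]; exact hgood _ hkol.mem_place
  have h2v : ((2 : ℕ) : 𝓞 K) ∉ hkol.place.asIdeal :=
    not_natCast_mem_of_prime_ne hkol.prime Nat.prime_two hℓ2 hkol.place hkol.mem_place
  have hqv : ((((N : ℕ) : ℤ)) : 𝓞 K) ∉ hkol.place.asIdeal := by
    rw [Int.cast_natCast, hN, Nat.cast_pow]
    exact fun h ↦ h2v (hkol.place.isPrime.mem_of_pow_mem M h)
  exact absGaloisRestrict_smul_geomTorsion_eq_of_kolyvaginPrime X hK hkol hfrob hbad hqv g Q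

/-- ★ **RESIDUE c v3, clause «the Kolyvagin primes' level: `X[4^κ] ⊆ X(K_q)`» (l.113–120), for the rows' `Kol`**
of `…CebotarevKernelPairSylvester` and the assembler's `3p ∣ N_A`: both curves of the Sylvester pair, display order
and spelling.  Good reduction at `λ ∤ 3p` by HSY 2019 §1 (`hasGoodReductionAt_cubeSumCurve_{three_mul_sq,prime}_baseChange`).
[cite: McCallumLMS1991, §4] [cite: HuShuYin2019, §1 p. 4] -/
theorem kolyvaginLevel_trivial_sylvesterPair {ω : K} (hω : ω ^ 2 + ω + 1 = 0) (h2 : Module.finrank ℚ K = 2)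
    {p : ℕ} (hp : p.Prime) (hp3 : p % 3 = 1) (κ : ℕ) (hκ : 1 ≤ κ) {NA NB : ℕ} (hNA : 3 * p ∣ NA) (b₀ : ℕ) :
    (∀ r : ℕ, (r.Prime ∧ ¬ r ∣ NA ∧ ¬ r ∣ NB ∧ ¬ ((r : ℤ) ∣ NumberField.discr K) ∧ r ≠ 2 ∧
        (Ideal.span {(r : 𝓞 K)}).IsPrime ∧
        FrobEqFrobInfty (cubeSumCurve (3 * (p : ℚ) ^ 2)) K (2 ^ κ * 2 ^ κ) r ∧
        FrobEqFrobInfty (cubeSumCurve (p : ℚ)) K (2 ^ κ * 2 ^ κ) r ∧ b₀ < r) →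
      ∀ q : HeightOneSpectrum (𝓞 K), (r : 𝓞 K) ∈ q.asIdeal →
      ∀ (g : absoluteGaloisGroup (Place.Completion (Sum.inr q : Place K)))
        (Q : geomTorsion ((cubeSumCurve (3 * (p : ℚ) ^ 2)).baseChange K) ((2 ^ κ * 2 ^ κ : ℕ) : ℤ)),
        absGaloisRestrict K (Place.Completion (Sum.inr q : Place K)) g • Q = Q) ∧
    (∀ r : ℕ, (r.Prime ∧ ¬ r ∣ NA ∧ ¬ r ∣ NB ∧ ¬ ((r : ℤ) ∣ NumberField.discr K) ∧ r ≠ 2 ∧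
        (Ideal.span {(r : 𝓞 K)}).IsPrime ∧
        FrobEqFrobInfty (cubeSumCurve (3 * (p : ℚ) ^ 2)) K (2 ^ κ * 2 ^ κ) r ∧
        FrobEqFrobInfty (cubeSumCurve (p : ℚ)) K (2 ^ κ * 2 ^ κ) r ∧ b₀ < r) →
      ∀ q : HeightOneSpectrum (𝓞 K), (r : 𝓞 K) ∈ q.asIdeal →
      ∀ (g : absoluteGaloisGroup (Place.Completion (Sum.inr q : Place K)))
        (Q : geomTorsion ((cubeSumCurve (p : ℚ)).baseChange K) ((2 ^ κ * 2 ^ κ : ℕ) : ℤ)),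
        absGaloisRestrict K (Place.Completion (Sum.inr q : Place K)) g • Q = Q) := by
  have hp2 : p ≠ 2 := by rintro rfl; norm_num at hp3
  have hp0 : (p : ℚ) ≠ 0 := by exact_mod_cast hp.ne_zero
  haveI := Rank1Residual.X12.CubeSumFamilies.isElliptic_cubeSumCurve hp0
  haveI := Rank1Residual.X12.CubeSumFamilies.isElliptic_cubeSumCurve
    (mul_ne_zero (by norm_num) (pow_ne_zero 2 hp0) : (3 * (p : ℚ) ^ 2) ≠ 0)
  haveI : NeZero (2 ^ κ * 2 ^ κ) := inferInstance
  have hK : IsImaginaryQuadratic K := JZero.isImaginaryQuadratic_of_sq_add_self_add_one hω h2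
  have hlev : 2 ^ κ * 2 ^ κ = 2 ^ (2 * κ) := by rw [two_mul, pow_add]
  -- `r ∤ N_A ⊇ 3p` puts `λ` off `3p`, where both curves have good reduction
  have hoff : ∀ r : ℕ, r.Prime → ¬ r ∣ NA → ∀ w : HeightOneSpectrum (𝓞 K), (r : 𝓞 K) ∈ w.asIdeal →
      ((3 : ℕ) : 𝓞 K) ∉ w.asIdeal ∧ ((p : ℕ) : 𝓞 K) ∉ w.asIdeal := by
    intro r hr hrN w hrw
    have hr3 : r ≠ 3 := fun h ↦ hrN (h ▸ (dvd_mul_right 3 p).trans hNA)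
    have hrp : r ≠ p := fun h ↦ hrN (h ▸ (dvd_mul_left p 3).trans hNA)
    exact ⟨not_natCast_mem_of_prime_ne hr Nat.prime_three hr3 w hrw, not_natCast_mem_of_prime_ne hr hp hrp w hrw⟩
  refine ⟨fun r hr ↦ ?_, fun r hr ↦ ?_⟩
  · obtain ⟨hrp, hrA, -, hrd, hr2, hrP, hFA, -, -⟩ := hr
    exact absGaloisRestrict_smul_geomTorsion_eq_of_frob_of_good (cubeSumCurve (3 * (p : ℚ) ^ 2)) hK hrp hrA hrd
      hr2 hrP (2 ^ κ * 2 ^ κ) hlev (by omega) hFA fun w hw ↦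
        hasGoodReductionAt_cubeSumCurve_three_mul_sq_baseChange hp hp2 w (hoff r hrp hrA w hw).1 (hoff r hrp hrA w hw).2
  · obtain ⟨hrp, hrA, -, hrd, hr2, hrP, -, hFB, -⟩ := hr
    exact absGaloisRestrict_smul_geomTorsion_eq_of_frob_of_good (cubeSumCurve (p : ℚ)) hK hrp hrA hrd
      hr2 hrP (2 ^ κ * 2 ^ κ) hlev (by omega) hFB fun w hw ↦
        hasGoodReductionAt_cubeSumCurve_prime_baseChange hp hp2 w (hoff r hrp hrA w hw).1 (hoff r hrp hrA w hw).2

end Summit.BirchSwinnertonDyer.BirchSwinnertonDyer.Theorems.SylvesterTwoCoupledTelescope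

end
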